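import Mathlib.LinearAlgebra.Dimension.Constructions
import Mathlib.LinearAlgebra.FiniteDimensional.Basic
import Literature.Computability.AlgebraicComplexity.FlatteningRank
import Summits.MatrixMultiplication.MatrixMultiplication.Theses.HessianPlane
import HarnessLib

/-!
# Route HessianPlane — support item `LowerFrame`: `3^N ≤ R(u(a,b,c)^{⊠N})` off the origin

Route `HessianPlane` of `MatrixMultiplication`, item stmt-MatrixMultiplication-4897 (`LowerFrame`).

For `(a,b,c) ∈ ℂ³` let `u(a,b,c)(x,y,z) = [x+y+z ≡ 0]·![a,b,c](y−x)` on `Fin 3 × Fin 3 × Fin 3` (the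
translation-invariantly weighted `ℤ/3` addition table, Nurmiev's semisimple normal form of the
Hessian plane). The three `x`-slices of `u(a,b,c)` have pairwise disjoint supports
`{(y,z) : z = −x−y}` and each slice carries every weight `a, b, c` exactly once; hence for
`(a,b,c) ≠ 0` they are linearly independent and the flattening rank `ζ⁽¹⁾(u) = 3`
(`hessianTable_flatteningRank`). Since `ζ⁽¹⁾` is multiplicative under Kronecker powers
(`flatteningRank_kroneckerPow`) and bounds the tensor rank from below
(`flatteningRank_le_tensorRank`, Bläser 2013, proof of Lemma 7.1(2); BCS (14.8)), we get
`3^N = ζ⁽¹⁾(u^{⊠N}) ≤ R(u^{⊠N})` for every `N` — the route decl `LowerFrame`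
(`lowerFrame_proof`), which makes "asymptotic rank `= 3` off the origin" meaningful.

## References

* P. Bürgisser, M. Clausen, M. A. Shokrollahi, *Algebraic Complexity Theory* (1997), (14.8)
  (flattening rank bounds rank). [BurgisserClausenShokrollahi1997]
* A. Conner, F. Gesmundo, J. M. Landsberg, E. Ventura, *Rank and border rank of Kronecker powers of
  tensors and Strassen's laser method*, comput. complexity 31 (2022). [ConnerGesmundoLandsbergVentura2022]
-/

-- the tree's namespace `Summit.MatrixMultiplication.MatrixMultiplication.…` repeats a component by design
set_option linter.dupNamespace false

namespace Summit.MatrixMultiplication.MatrixMultiplication.Theorems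

open Literature.Computability.AlgebraicComplexity Module Submodule

/-- The `x`-slices of the weighted `ℤ/3` table `u(a,b,c)(x,y,z) = [x+y+z ≡ 0]·![a,b,c](y−x)` are
linearly independent as soon as `(a,b,c) ≠ 0`: if the weight `![a,b,c] k ≠ 0`, evaluating a
vanishing combination `∑ₓ gₓ • sliceₓ` at the point `(x+k, x+2k)` — which lies in the support of
`sliceₓ` only, with value `![a,b,c] k` there — gives `gₓ = 0`. [folklore] -/
theorem hessianTable_xSlices_linearIndependent (a b c : ℂ) (h : a ≠ 0 ∨ b ≠ 0 ∨ c ≠ 0) :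
    LinearIndependent ℂ (xSlices (K := ℂ)
      (fun x y z : Fin 3 => if x + y + z = 0 then ![a, b, c] (y - x) else (0 : ℂ))) := by
  obtain ⟨k, hk⟩ : ∃ k : Fin 3, ![a, b, c] k ≠ 0 := by
    rcases h with h | h | h
    · exact ⟨0, by simpa using h⟩
    · exact ⟨1, by simpa using h⟩
    · exact ⟨2, by simpa using h⟩
  have h1 : ∀ x k : Fin 3, x + (x + k) + (x + 2 * k) = 0 := by decide
  have h2 : ∀ x x' k : Fin 3, x' ≠ x → ¬ (x' + (x + k) + (x + 2 * k) = 0) := by decide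
  have h3 : ∀ x k : Fin 3, x + k - x = k := by decide
  rw [Fintype.linearIndependent_iff]
  intro g hg x
  have hx := congrFun hg (x + k, x + 2 * k)
  rw [Finset.sum_apply, Pi.zero_apply, Finset.sum_eq_single x] at hx
  · simp only [Pi.smul_apply, xSlices_apply, smul_eq_mul, if_pos (h1 x k), h3] at hx
    exact (mul_eq_zero.1 hx).resolve_right hk
  · intro x' _ hne
    simp only [Pi.smul_apply, xSlices_apply, smul_eq_mul, if_neg (h2 x x' k hne), mul_zero]
  · intro hx'
    exact absurd (Finset.mem_univ x) hx'

/-- The flattening rank of the weighted `ℤ/3` table is `3` off the origin: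
`ζ⁽¹⁾(u(a,b,c)) = 3` for `(a,b,c) ≠ 0` (three linearly independent slices). [folklore] -/
theorem hessianTable_flatteningRank (a b c : ℂ) (h : a ≠ 0 ∨ b ≠ 0 ∨ c ≠ 0) :
    flatteningRank (fun x y z : Fin 3 => if x + y + z = 0 then ![a, b, c] (y - x) else (0 : ℂ)) = 3 := by
  unfold flatteningRank
  rw [finrank_span_eq_card (hessianTable_xSlices_linearIndependent a b c h), Fintype.card_fin]

/-- **Route decl `LowerFrame`** (item stmt-MatrixMultiplication-4897): for `(a,b,c) ≠ 0` and all
`N`, `3^N ≤ R(u(a,b,c)^{⊠N})`. Proof: `3^N = ζ⁽¹⁾(u)^N = ζ⁽¹⁾(u^{⊠N}) ≤ R(u^{⊠N})` by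
multiplicativity of the flattening rank under Kronecker powers and `ζ⁽¹⁾ ≤ R`
(Bläser 2013, proof of Lemma 7.1(2); BCS (14.8)). [folklore] -/
theorem lowerFrame_proof :
    Summit.MatrixMultiplication.MatrixMultiplication.Theses.HessianPlane.LowerFrame := by
  unfold Summit.MatrixMultiplication.MatrixMultiplication.Theses.HessianPlane.LowerFrame
  intro a b c h N
  calc 3 ^ N = flatteningRank (kroneckerPow
          (fun x y z : Fin 3 => if x + y + z = 0 then ![a, b, c] (y - x) else (0 : ℂ)) N) := by
        rw [flatteningRank_kroneckerPow, hessianTable_flatteningRank a b c h]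
    _ ≤ _ := flatteningRank_le_tensorRank _

end Summit.MatrixMultiplication.MatrixMultiplication.Theorems
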